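import Literature.NumberTheory.LFunctions.HalaszRestrictedMeanSquare
import Literature.NumberTheory.LFunctions.HalaszIntegration
import HarnessLib

/-!
# Halász's theorem for block-restricted sums, III: the theorem

Third and last file (after `HalaszRestrictedEuler.lean`, `HalaszRestrictedMeanSquare.lean`).  For a
completely multiplicative `g : ℕ → ℂ` with `|g| ≤ 1`, a block system `blk i` (`i ∈ 𝓙`) of pairwise
disjoint sets of primes `≤ min(x, Q)` and `𝒮 = {n : n has a prime factor in every block}`, we prove
**Halász's theorem for the restricted sum** (`norm_restr_sum_le`): there is an absolute `K` with

`|∑_{n ≤ x, n ∈ 𝒮} g(n)| ≤ K x ((1 + M_½) e^{-M_½} + 1/T + (|𝓙| + 1) √((log Q + 2)/log x))`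

for `x ≥ 3`, `T ≥ 4`, `Q ≥ e²`, where `M_½ = min_{|t| ≤ T} 𝔻_½(g, n^{it}; x)²` is the minimum of the
HALVED distance (`Restricted.halfDistSq`: weight `1/2` on the primes of the blocks, `1` elsewhere;
`M_½ ≥ M/2`, `minHalfDistSq_ge_half`).  Compared with Halász's theorem for `g` itself
(`Halasz.norm_S_le_of_completelyMultiplicative`, tree): the restriction to `𝒮` costs only the halving of
the blocks' part of the distance — no factor `2^{|𝓙|}`, no sieve density — and the error `1/T` is of
Granville–Soundararajan quality.  The proof is theirs (Canad. J. Math. 2003, §§2–4), run for the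
non-multiplicative `a = g̃ 1_𝒮` with the two structural substitutes of parts I–II:

* `norm_S_restr_mul_log_le` — **Lemma 2.1 / (A1) for `a`**: `|S_a(y)| log y ≤ ∑_{d ≤ y} Λ(d)|S_a(y/d)| + (1 + 2L) y`
  whenever `∑_{p ∈ E} log p/p ≤ L` (`E = ⋃ blk i`): for `d = p^k` with `p ∉ E`, `a(dm) = g̃(d) a(m)`;
  the `d = p^k` with `p ∈ E` contribute `≤ y ∑_{p ∈ E} ∑_k log p/p^k ≤ 2Ly`;
* `norm_S_restr_mul_log_le_integral` — (A2) `|S_a(x)| log x ≤ x ∫_{log 2}^{log x} |S_a(e^u)| e^{-u} du + C x`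
  (the tree's Abel summation against the prime number theorem, verbatim);
* `inner_integral_restr_le` — (3.8): Cauchy–Schwarz in `u` with the mean square of part II,
  `I(α) ≤ 5B/α + e^{12}|𝓙|√(36 log Q + 25) α^{-3/2} + (7/√T₀ + 18/T₀) α^{-1/2} + 10e⁵/(α² T₀)`;
* `norm_restr_sum_le` — the `α`-integration of GS03 §4 (two regimes split at `α₁ = min(1, 1/B_w)`,
  `B_w = e⁷ log x · e^{-M_½}` from `norm_LSeries_restr_one_line_le` and Poisson smoothing), with the two
  extra integrals `∫ α^{-3/2} ≤ 2√(2 log x)`, `∫ α^{-1/2} ≤ 2`, and `M_½ ≤ log log x + 30` to absorb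
  `log log x/log x`.

## References
* A. Granville, K. Soundararajan, *Decay of mean values of multiplicative functions*, Canad. J.
  Math. 55 (2003), Lemma 2.1, §3b, §4, Theorem 1 / Corollary 1. [cite: GranvilleSoundararajan2003, Theorem 1]
* K. Matomäki, M. Radziwiłł, arXiv:2007.04290, Remark after Theorem 9.2 (the weaker `2^J M e^{-M/2}`
  for restricted main terms, by inclusion–exclusion).

## Design choices
* Blocks indexed by `ℕ` in the final statement (`𝓙 : Finset ℕ`, `blk : ℕ → Finset ℕ`), as in the
  application (Matomäki–Radziwiłł interval systems `[P_j, Q_j]`, `j ≤ J`); the lemmas are stated for any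
  index type.
* `T ≥ 4`, `x ≥ 3`, `Q ≥ e²`; constants explicit but astronomically crude.
-/

noncomputable section

open Finset Real Complex MeasureTheory
open scoped ComplexConjugate

namespace Literature.NumberTheory.LFunctions

namespace Halasz

namespace Restricted

open MellinPlancherel (psum)
open ArithmeticFunction (vonMangoldt)

variable {ι : Type*} {𝓙 : Finset ι} {blk : ι → Finset ℕ} {g : ℕ → ℂ} {N : ℕ}

/-! ### Lemma A1 for the restricted function -/

/-- `∑_{n ≤ y} a(n) log n = ∑_{d ≤ y} ∑_{m ≤ y/d} Λ(d) a(dm)` for any sequence `a`. [folklore] -/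
theorem sum_mul_log_eq_sum_sum (a : ℕ → ℂ) (y : ℝ) :
    ∑ n ∈ Finset.Icc 1 ⌊y⌋₊, a n * (Real.log n : ℂ) =
      ∑ d ∈ Finset.Icc 1 ⌊y⌋₊, ∑ m ∈ Finset.Icc 1 (⌊y⌋₊ / d), (vonMangoldt d : ℂ) * a (d * m) := by
  have h1 : ∀ n ∈ Finset.Icc 1 ⌊y⌋₊, a n * (Real.log n : ℂ) = ∑ d ∈ n.divisors, (vonMangoldt d : ℂ) * a n := by
    intro n _
    rw [← Finset.sum_mul, ← Complex.ofReal_sum, ArithmeticFunction.vonMangoldt_sum, mul_comm]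
  rw [Finset.sum_congr rfl h1, sum_Icc_sum_divisors_eq (fun d n => (vonMangoldt d : ℂ) * a n)]

/-- For a prime `p`: `∑_{d ≤ Y, p ∣ d} Λ(d)/d ≤ 2 log p/p` (the `d` that count are `p^k`, `k ≥ 1`, and
`∑_k p^{-k} ≤ 1/(p-1) ≤ 2/p`). [folklore] -/
theorem sum_vonMangoldt_div_filter_dvd_le {p : ℕ} (hp : p.Prime) (Y : ℕ) :
    ∑ d ∈ (Finset.Icc 1 Y).filter (p ∣ ·), (vonMangoldt d : ℝ) / d ≤ 2 * Real.log p / p := by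
  classical
  have hp2 : (2 : ℝ) ≤ p := by exact_mod_cast hp.two_le
  have hp0 : (0 : ℝ) < p := by linarith
  have hlogp : 0 ≤ Real.log p := Real.log_nonneg (by linarith)
  set S := ((Finset.Icc 1 Y).filter (p ∣ ·)).filter (fun n => IsPrimePow n) with hS
  have hsplit : ∑ d ∈ (Finset.Icc 1 Y).filter (p ∣ ·), (vonMangoldt d : ℝ) / d = ∑ d ∈ S, (vonMangoldt d : ℝ) / d := by
    rw [hS]
    refine (Finset.sum_filter_of_ne fun n _ hne => ?_).symm
    have : (vonMangoldt n : ℝ) ≠ 0 := by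
      intro h0; rw [h0, zero_div] at hne; exact hne rfl
    exact ArithmeticFunction.vonMangoldt_ne_zero_iff.mp this
  -- `S ⊆ {p^k : 1 ≤ k ≤ log_p Y}` and on `S` the term is `log p / p^k`
  set K := Nat.log p Y with hK
  have hsub : S ⊆ (Finset.Icc 1 K).image (fun k => p ^ k) := by
    intro n hn
    simp only [hS, Finset.mem_filter, Finset.mem_Icc] at hn
    obtain ⟨⟨⟨-, hnY⟩, hpn⟩, hpp⟩ := hn
    obtain ⟨q, k, hq, hk, rfl⟩ := (isPrimePow_nat_iff _).mp hpp
    have hqp : p = q := (prime_dvd_primePow_iff hq hp hk).mp hpn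
    subst hqp
    exact Finset.mem_image.mpr ⟨k, Finset.mem_Icc.mpr ⟨hk, Nat.le_log_of_pow_le hp.one_lt hnY⟩, rfl⟩
  have hterm_img : ∀ k ∈ Finset.Icc 1 K, (vonMangoldt (p ^ k) : ℝ) / (p ^ k : ℕ) = Real.log p * (1 / (p : ℝ)) ^ k := by
    intro k hk
    rw [Finset.mem_Icc] at hk
    rw [ArithmeticFunction.vonMangoldt_apply_pow (by omega), ArithmeticFunction.vonMangoldt_apply_prime hp]
    push_cast
    rw [div_pow, one_pow, div_eq_mul_one_div]
  have hinj : Set.InjOn (fun k => p ^ k) (Finset.Icc 1 K : Set ℕ) :=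
    fun a _ b _ hab => Nat.pow_right_injective hp.two_le hab
  have hnonneg : ∀ d ∈ (Finset.Icc 1 K).image (fun k => p ^ k), 0 ≤ (vonMangoldt d : ℝ) / d :=
    fun d _ => div_nonneg ArithmeticFunction.vonMangoldt_nonneg (Nat.cast_nonneg d)
  calc ∑ d ∈ (Finset.Icc 1 Y).filter (p ∣ ·), (vonMangoldt d : ℝ) / d = ∑ d ∈ S, (vonMangoldt d : ℝ) / d := hsplit
    _ ≤ ∑ d ∈ (Finset.Icc 1 K).image (fun k => p ^ k), (vonMangoldt d : ℝ) / d :=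
        Finset.sum_le_sum_of_subset_of_nonneg hsub fun d hd _ => hnonneg d hd
    _ = ∑ k ∈ Finset.Icc 1 K, (vonMangoldt (p ^ k) : ℝ) / (p ^ k : ℕ) := Finset.sum_image hinj
    _ = ∑ k ∈ Finset.Icc 1 K, Real.log p * (1 / (p : ℝ)) ^ k := Finset.sum_congr rfl hterm_img
    _ = Real.log p * ∑ k ∈ Finset.Ico 1 (K + 1), (1 / (p : ℝ)) ^ k := by
        rw [← Finset.mul_sum, Finset.Ico_add_one_right_eq_Icc]
    _ ≤ Real.log p * ((1 / (p : ℝ)) ^ 1 / (1 - 1 / p)) := by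
        gcongr
        exact geom_sum_Ico_le_of_lt_one (by positivity) (by rw [div_lt_one hp0]; linarith)
    _ = Real.log p / (p - 1) := by
        field_simp
    _ ≤ 2 * Real.log p / p := by
        rw [div_le_div_iff₀ (by linarith) hp0]
        nlinarith

/-- The prime powers of primes of `E` up to `Y`: `∑_{d ≤ Y, (d,E) ≠ 1} Λ(d)/d ≤ 2 ∑_{p ∈ E} log p/p`. [folklore] -/
theorem sum_vonMangoldt_div_le_of_primes {E : Finset ℕ} (hE : ∀ p ∈ E, p.Prime) (Y : ℕ) :
    ∑ d ∈ (Finset.Icc 1 Y).filter (fun d => ∃ p ∈ E, p ∣ d), (vonMangoldt d : ℝ) / d ≤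
      2 * ∑ p ∈ E, Real.log p / p := by
  classical
  calc ∑ d ∈ (Finset.Icc 1 Y).filter (fun d => ∃ p ∈ E, p ∣ d), (vonMangoldt d : ℝ) / d
      ≤ ∑ d ∈ (Finset.Icc 1 Y).filter (fun d => ∃ p ∈ E, p ∣ d), ∑ p ∈ E, if p ∣ d then (vonMangoldt d : ℝ) / d else 0 := by
        refine Finset.sum_le_sum fun d hd => ?_
        obtain ⟨p₀, hp₀, hdvd⟩ := (Finset.mem_filter.mp hd).2
        calc (vonMangoldt d : ℝ) / d = if p₀ ∣ d then (vonMangoldt d : ℝ) / d else 0 := by rw [if_pos hdvd]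
          _ ≤ ∑ p ∈ E, if p ∣ d then (vonMangoldt d : ℝ) / d else 0 :=
              Finset.single_le_sum (f := fun p => if p ∣ d then (vonMangoldt d : ℝ) / d else 0)
                (fun p _ => by split_ifs <;> [exact div_nonneg ArithmeticFunction.vonMangoldt_nonneg (Nat.cast_nonneg d); exact le_rfl])
                hp₀
    _ ≤ ∑ d ∈ Finset.Icc 1 Y, ∑ p ∈ E, if p ∣ d then (vonMangoldt d : ℝ) / d else 0 :=
        Finset.sum_le_sum_of_subset_of_nonneg (Finset.filter_subset _ _) fun d _ _ =>
          Finset.sum_nonneg fun p _ => by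
            split_ifs <;> [exact div_nonneg ArithmeticFunction.vonMangoldt_nonneg (Nat.cast_nonneg d); exact le_rfl]
    _ = ∑ p ∈ E, ∑ d ∈ (Finset.Icc 1 Y).filter (p ∣ ·), (vonMangoldt d : ℝ) / d := by
        rw [Finset.sum_comm]
        refine Finset.sum_congr rfl fun p _ => ?_
        rw [Finset.sum_filter]
    _ ≤ ∑ p ∈ E, 2 * Real.log p / p := Finset.sum_le_sum fun p hp => sum_vonMangoldt_div_filter_dvd_le (hE p hp) Y
    _ = 2 * ∑ p ∈ E, Real.log p / p := by rw [Finset.mul_sum]; exact Finset.sum_congr rfl fun p _ => by ring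

/-- **Lemma A1 for the restricted function**: for a block system, `g` completely multiplicative with
`|g| ≤ 1`, `∑_{p ∈ E} log p/p ≤ L` and `y ≥ 1`,
`‖S_a(y)‖ log y ≤ ∑_{d ≤ y} Λ(d) ‖S_a(y/d)‖ + (1 + 2L) y`, `a = g̃ 1_𝒮`.
[cite: GranvilleSoundararajan2003, Lemma 2.1] -/
theorem norm_S_restr_mul_log_le [DecidableEq ι] (h : IsBlockSystem 𝓙 blk N)
    (hg : ∀ m n, g (m * n) = g m * g n) (hgb : ∀ n, ‖g n‖ ≤ 1) {L : ℝ}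
    (hL : ∑ p ∈ 𝓙.biUnion blk, Real.log p / p ≤ L) {y : ℝ} (hy : 1 ≤ y) :
    ‖S (restr 𝓙 blk g N) y‖ * Real.log y ≤
      ∑ d ∈ Finset.Icc 1 ⌊y⌋₊, vonMangoldt d * ‖S (restr 𝓙 blk g N) (y / d)‖ + (1 + 2 * L) * y := by
  set a := restr 𝓙 blk g N with ha
  set E := 𝓙.biUnion blk with hE
  have hEprime : ∀ q ∈ E, q.Prime := fun q hq => h.prime_of_mem_biUnion (t := 𝓙) le_rfl hq
  have hblkprime : ∀ i ∈ 𝓙, ∀ q ∈ blk i, q.Prime := fun i hi q hq => h.prime_of_mem hi hq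
  have hy0 : 0 < y := by linarith
  have hab : ∀ n, ‖a n‖ ≤ 1 := norm_restr_le_one hgb
  -- the inner sums
  set T : ℕ → ℂ := fun d => ∑ m ∈ Finset.Icc 1 (⌊y⌋₊ / d), (vonMangoldt d : ℂ) * a (d * m) with hT
  have hTle : ∀ d ∈ Finset.Icc 1 ⌊y⌋₊, ‖T d‖ ≤ vonMangoldt d * ‖S a (y / d)‖ +
      y * (if ∃ p ∈ E, p ∣ d then (vonMangoldt d : ℝ) / d else 0) := by
    intro d hd
    rw [Finset.mem_Icc] at hd
    have hd0 : (0 : ℝ) < d := by exact_mod_cast hd.1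
    by_cases hΛ : (vonMangoldt d : ℝ) = 0
    · have : T d = 0 := Finset.sum_eq_zero fun m _ => by simp [hΛ]
      rw [this, norm_zero, hΛ]
      simp only [zero_mul, zero_div, ite_self, mul_zero, add_zero, le_refl]
    obtain ⟨p, k, hp, hk, rfl⟩ := exists_eq_pow_of_vonMangoldt_ne_zero hΛ
    by_cases hpE : p ∈ E
    · -- crude bound `≤ Λ(d) · (y/d)`
      have hex : ∃ q ∈ E, q ∣ p ^ k := ⟨p, hpE, dvd_pow_self p hk.ne'⟩
      rw [if_pos hex]
      have h1 : ‖T (p ^ k)‖ ≤ ∑ m ∈ Finset.Icc 1 (⌊y⌋₊ / p ^ k), (vonMangoldt (p ^ k) : ℝ) := by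
        refine (norm_sum_le _ _).trans (Finset.sum_le_sum fun m _ => ?_)
        rw [norm_mul, Complex.norm_real, Real.norm_of_nonneg ArithmeticFunction.vonMangoldt_nonneg]
        exact mul_le_of_le_one_right ArithmeticFunction.vonMangoldt_nonneg (hab _)
      rw [Finset.sum_const, Nat.card_Icc, nsmul_eq_mul] at h1
      have hcount : (((⌊y⌋₊ / p ^ k + 1 - 1 : ℕ)) : ℝ) ≤ y / (p ^ k : ℕ) := by
        rw [Nat.add_sub_cancel, le_div_iff₀ hd0]
        calc ((⌊y⌋₊ / p ^ k : ℕ) : ℝ) * ((p ^ k : ℕ) : ℝ) = (((⌊y⌋₊ / p ^ k) * p ^ k : ℕ) : ℝ) := by push_cast; ring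
          _ ≤ (⌊y⌋₊ : ℝ) := by exact_mod_cast Nat.div_mul_le_self _ _
          _ ≤ y := Nat.floor_le hy0.le
      have hS0 : 0 ≤ vonMangoldt (p ^ k) * ‖S a (y / (p ^ k : ℕ))‖ := by positivity
      calc ‖T (p ^ k)‖ ≤ ((⌊y⌋₊ / p ^ k + 1 - 1 : ℕ) : ℝ) * vonMangoldt (p ^ k) := h1
        _ ≤ y / (p ^ k : ℕ) * vonMangoldt (p ^ k) := by gcongr
        _ = y * ((vonMangoldt (p ^ k) : ℝ) / (p ^ k : ℕ)) := by ring
        _ ≤ _ := le_add_of_nonneg_left hS0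
    · -- exact factorisation `a(dm) = g̃(d) a(m)`
      have hpE' : ∀ i ∈ 𝓙, p ∉ blk i := fun i hi hpi => hpE (Finset.mem_biUnion.mpr ⟨i, hi, hpi⟩)
      have hfac : ∀ m : ℕ, a (p ^ k * m) = smoothCut g N (p ^ k) * a m := by
        intro m
        simp only [ha, restr]
        rw [smoothCut_mul hg, blockInd_primePow_mul hblkprime hp hpE' m]
        ring
      have hTeq : T (p ^ k) = (vonMangoldt (p ^ k) : ℂ) * smoothCut g N (p ^ k) * S a (y / (p ^ k : ℕ)) := by
        simp only [hT, S]
        rw [Nat.floor_div_natCast, Finset.mul_sum]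
        exact Finset.sum_congr rfl fun m _ => by rw [hfac m]; ring
      have hnot : ¬ ∃ q ∈ E, q ∣ p ^ k := by
        rintro ⟨q, hq, hqd⟩
        exact hpE ((prime_dvd_primePow_iff hp (hEprime q hq) hk).mp hqd ▸ hq)
      rw [if_neg hnot, mul_zero, add_zero, hTeq, norm_mul, norm_mul, Complex.norm_real,
        Real.norm_of_nonneg ArithmeticFunction.vonMangoldt_nonneg]
      calc vonMangoldt (p ^ k) * ‖smoothCut g N (p ^ k)‖ * ‖S a (y / (p ^ k : ℕ))‖
          ≤ vonMangoldt (p ^ k) * 1 * ‖S a (y / (p ^ k : ℕ))‖ := by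
            gcongr
            exact norm_smoothCut_le hgb _
        _ = _ := by rw [mul_one]
  -- assemble
  have h0 := norm_S_mul_log_le_norm_sum hab hy
  rw [sum_mul_log_eq_sum_sum a y] at h0
  have h1 : ‖∑ d ∈ Finset.Icc 1 ⌊y⌋₊, T d‖ ≤ ∑ d ∈ Finset.Icc 1 ⌊y⌋₊, vonMangoldt d * ‖S a (y / d)‖ +
      y * (2 * L) := by
    refine (norm_sum_le _ _).trans ((Finset.sum_le_sum hTle).trans ?_)
    rw [Finset.sum_add_distrib, ← Finset.mul_sum]
    gcongr
    rw [← Finset.sum_filter]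
    exact (sum_vonMangoldt_div_le_of_primes hEprime ⌊y⌋₊).trans (by linarith)
  have hTsum : ∑ d ∈ Finset.Icc 1 ⌊y⌋₊, ∑ m ∈ Finset.Icc 1 (⌊y⌋₊ / d), (vonMangoldt d : ℂ) * a (d * m) =
      ∑ d ∈ Finset.Icc 1 ⌊y⌋₊, T d := rfl
  rw [hTsum] at h0
  linarith

/-! ### Lemma A2 for the restricted function -/

/-- **Lemma A2 for `a = g̃ 1_𝒮`** (GS03 Lemma 2.1, (2.1)): if `C` is the constant of the tree's
`Halasz.exists_sum_abs_psi_sub_mul_kk_le`, then for `x ≥ 3` and `∑_{p ∈ E} log p/p ≤ L`,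
`‖S_a(x)‖ log x ≤ x ∫_{log 2}^{log x} ‖S_a(e^u)‖ e^{-u} du + (C + 4 + 2L) x`. [cite: GranvilleSoundararajan2003, Lemma 2.1, (2.1)] -/
theorem norm_S_restr_mul_log_le_integral {C : ℝ}
    (hC : ∀ x : ℝ, 3 ≤ x → ∑ d ∈ Finset.Icc 1 ⌊x⌋₊, |Chebyshev.psi d - d| * kk x d ≤ C * x)
    [DecidableEq ι] (h : IsBlockSystem 𝓙 blk N) (hg : ∀ m n, g (m * n) = g m * g n)
    (hgb : ∀ n, ‖g n‖ ≤ 1) {L : ℝ} (hL : ∑ p ∈ 𝓙.biUnion blk, Real.log p / p ≤ L) {x : ℝ} (hx : 3 ≤ x) :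
    ‖S (restr 𝓙 blk g N) x‖ * Real.log x ≤
      x * (∫ u in Real.log 2..Real.log x, normSExp (restr 𝓙 blk g N) u) + (C + 4 + 2 * L) * x := by
  have hab : ∀ n, ‖restr 𝓙 blk g N n‖ ≤ 1 := norm_restr_le_one hgb
  have hx1 : 1 ≤ x := by linarith
  have hx0 : 0 < x := by linarith
  have h1 := norm_S_restr_mul_log_le h hg hgb hL hx1
  have h2 := sum_vonMangoldt_mul_le (g := restr 𝓙 blk g N) hab hx1
  have h3 := hC x hx
  have h4 := sum_norm_S_div_le (g := restr 𝓙 blk g N) hab hx1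
  have hYx : (⌊x⌋₊ : ℝ) ≤ x := Nat.floor_le hx0.le
  have hsplit : ∫ u in (0:ℝ)..Real.log x, normSExp (restr 𝓙 blk g N) u =
      (∫ u in (0:ℝ)..Real.log 2, normSExp (restr 𝓙 blk g N) u) +
        ∫ u in Real.log 2..Real.log x, normSExp (restr 𝓙 blk g N) u :=
    (intervalIntegral.integral_add_adjacent_intervals (intervalIntegrable_normSExp hab _ _)
      (intervalIntegrable_normSExp hab _ _)).symm
  have hsmall := integral_normSExp_small_le (g := restr 𝓙 blk g N) hab
  rw [hsplit] at h4
  have h5 : x * ∫ u in (0:ℝ)..Real.log 2, normSExp (restr 𝓙 blk g N) u ≤ x := by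
    calc x * ∫ u in (0:ℝ)..Real.log 2, normSExp (restr 𝓙 blk g N) u ≤ x * 1 :=
          mul_le_mul_of_nonneg_left hsmall hx0.le
      _ = x := mul_one x
  have hLy : 0 ≤ 2 * L * x := by
    have : 0 ≤ L := le_trans (Finset.sum_nonneg fun p hp => by
      have := (h.prime_of_mem_biUnion (t := 𝓙) le_rfl hp).one_lt
      exact div_nonneg (Real.log_nonneg (by exact_mod_cast this.le)) (Nat.cast_nonneg p)) hL
    positivity
  nlinarith

/-! ### The minimum of the halved distance -/

/-- `M_½(x, T) = min_{|t| ≤ T} 𝔻_½(g, n^{it}; x)²` (cf. `Literature.NumberTheory.Sieve.minPretentiousDistSq`),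
as an `iInf` over `t ∈ [-T, T]`; junk value `0` for `T < 0`. [folklore] -/
def minHalfDistSq (E : Finset ℕ) (g : ℕ → ℂ) (x T : ℝ) : ℝ :=
  ⨅ t : Set.Icc (-T) T, halfDistSq E g t x

/-- `M_½ ≤ 𝔻_½(g, n^{it}; x)²` for `|t| ≤ T`. [folklore] -/
theorem minHalfDistSq_le (hgb : ∀ n, ‖g n‖ ≤ 1) (E : Finset ℕ) (x : ℝ) {T t : ℝ} (ht : |t| ≤ T) :
    minHalfDistSq E g x T ≤ halfDistSq E g t x := by
  unfold minHalfDistSq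
  have hmem : t ∈ Set.Icc (-T) T := ⟨by linarith [neg_abs_le t, ht], (le_abs_self t).trans ht⟩
  refine ciInf_le_of_le ⟨0, ?_⟩ ⟨t, hmem⟩ le_rfl
  rintro _ ⟨s, rfl⟩
  exact halfDistSq_nonneg hgb E _ x

/-- `0 ≤ M_½` (`T ≥ 0`). [folklore] -/
theorem minHalfDistSq_nonneg (hgb : ∀ n, ‖g n‖ ≤ 1) (E : Finset ℕ) (x : ℝ) {T : ℝ} (hT : 0 ≤ T) :
    0 ≤ minHalfDistSq E g x T := by
  have : Nonempty (Set.Icc (-T) T) := ⟨⟨0, by simp [hT]⟩⟩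
  exact le_ciInf fun t => halfDistSq_nonneg hgb E _ x

/-- **`M_½ ≥ M/2`**: the minimum of the halved distance is at least half the minimum of the
pretentious distance over the same range (`T ≥ 0`). [folklore] -/
theorem minHalfDistSq_ge_half (hgb : ∀ n, ‖g n‖ ≤ 1) (E : Finset ℕ) (x : ℝ) {T : ℝ} (hT : 0 ≤ T) :
    Sieve.minPretentiousDistSq g x T / 2 ≤ minHalfDistSq E g x T := by
  have : Nonempty (Set.Icc (-T) T) := ⟨⟨0, by simp [hT]⟩⟩
  refine le_ciInf fun t => ?_
  have h1 := minPretentiousDistSq_le_of_abs_le hgb x (T := T) (t := (t : ℝ))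
    (abs_le.mpr ⟨by linarith [t.2.1], t.2.2⟩)
  have h2 := halfDistSq_ge_half hgb E (t : ℝ) x
  linarith

/-- `M_½ ≤ log log x + 30` for `x ≥ 3`, `T ≥ 1` (some `t ∈ [0,1]` has small distance). [folklore] -/
theorem minHalfDistSq_le_loglog (hgb : ∀ n, ‖g n‖ ≤ 1) (E : Finset ℕ) {x T : ℝ} (hx : 3 ≤ x) (hT : 1 ≤ T) :
    minHalfDistSq E g x T ≤ Real.log (Real.log x) + 30 := by
  obtain ⟨t, ht, hle⟩ := exists_pretentiousDistSq_le (g := g) hgb hx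
  have htT : |t| ≤ T := by rw [abs_of_nonneg ht.1]; exact ht.2.trans hT
  exact (minHalfDistSq_le hgb E x htT).trans ((halfDistSq_le hgb E t x).trans hle)

variable {x : ℝ}

/-- **The window from the halved distance**: for `|u| ≤ T`,
`‖𝒢_a(1+iu)‖ ≤ e⁷ log x · e^{-M_½(x,T)}`. [folklore] -/
theorem norm_LSeries_restr_window_le [DecidableEq ι] (h : IsBlockSystem 𝓙 blk ⌊x⌋₊)
    (hg : ∀ m n, g (m * n) = g m * g n) (hg1 : g 1 = 1) (hgb : ∀ n, ‖g n‖ ≤ 1) (hx : 3 ≤ x)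
    {T u : ℝ} (hu : |u| ≤ T) :
    ‖LSeries (restr 𝓙 blk g ⌊x⌋₊) (1 + u * I)‖ ≤
      Real.exp 7 * Real.log x * Real.exp (-minHalfDistSq (𝓙.biUnion blk) g x T) := by
  refine (norm_LSeries_restr_one_line_le h hg hg1 hgb hx u).trans ?_
  gcongr
  · exact mul_nonneg (Real.exp_pos _).le (Real.log_nonneg (by linarith))
  · exact minHalfDistSq_le hgb _ x hu

/-- **Poisson transport to `Re s = 1 + α`**: for `0 < α`, `T₀ > 0`, `|y| ≤ T₀`,
`‖𝒢_a(1+α+iy)‖ ≤ e⁷ log x · e^{-M_½(x, 2T₀)} + (2α/T₀) e⁵ log x`. [cite: GranvilleSoundararajan2003, (4.2)] -/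
theorem norm_LSeries_restr_shift_le [DecidableEq ι] (h : IsBlockSystem 𝓙 blk ⌊x⌋₊)
    (hg : ∀ m n, g (m * n) = g m * g n) (hg1 : g 1 = 1) (hgb : ∀ n, ‖g n‖ ≤ 1) (hx : 3 ≤ x)
    {α T₀ y : ℝ} (hα : 0 < α) (hT₀ : 0 < T₀) (hy : |y| ≤ T₀) :
    ‖LSeries (restr 𝓙 blk g ⌊x⌋₊) (1 + α + y * I)‖ ≤
      Real.exp 7 * Real.log x * Real.exp (-minHalfDistSq (𝓙.biUnion blk) g x (2 * T₀)) +
        2 * α / T₀ * (Real.exp 5 * Real.log x) := by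
  have hsum := summable_norm_restr_div_rpow (𝓙 := 𝓙) (blk := blk) (N := ⌊x⌋₊) hg hg1 hgb one_pos
  have hS := tsum_norm_restr_div_le (𝓙 := 𝓙) (blk := blk) hg hg1 hgb hx
  have hP := PoissonSmoothing.norm_LSeries_le_of_bound (α := α) hα (a := restr 𝓙 blk g ⌊x⌋₊)
    (σ₀ := 1) hsum hT₀ y
    (B := Real.exp 7 * Real.log x * Real.exp (-minHalfDistSq (𝓙.biUnion blk) g x (2 * T₀)))
    (fun u hu => by
      have := norm_LSeries_restr_window_le h hg hg1 hgb hx (T := 2 * T₀) (u := u) (by linarith)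
      simpa using this)
  push_cast at hP
  refine hP.trans ?_
  gcongr

/-! ### Cauchy–Schwarz in `u`: the bound for `I(α)` -/

/-- Sum of four squares is at most the square of the sum (nonnegative terms). [folklore] -/
theorem sq_add_four_le {a b c d : ℝ} (ha : 0 ≤ a) (hb : 0 ≤ b) (hc : 0 ≤ c) (hd : 0 ≤ d) :
    a ^ 2 + b ^ 2 + c ^ 2 + d ^ 2 ≤ (a + b + c + d) ^ 2 := by
  nlinarith [mul_nonneg ha hb, mul_nonneg ha hc, mul_nonneg ha hd, mul_nonneg hb hc, mul_nonneg hb hd,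
    mul_nonneg hc hd]

/-- The square-root bookkeeping: if `J ≤ 36B²/α + 2(e^{12}/α)² m² Λ + (1/π)(240/T₀ + (1920 + 520e^{10}/α³)/T₀²)`
then `√(J/(2α)) ≤ 5B/α + e^{12} m √Λ/(α√α) + (7/√T₀ + 18/T₀)/√α + 10e⁵/(α²T₀)`. [folklore] -/
theorem sqrt_meanSquare_bound_le {J B m Λ α T₀ : ℝ} (hα : 0 < α) (hT₀ : 1 ≤ T₀) (hB : 0 ≤ B) (hm : 0 ≤ m)
    (hΛ : 0 ≤ Λ)
    (hJ : J ≤ 36 * B ^ 2 / α + 2 * (Real.exp 12 / α) ^ 2 * m ^ 2 * Λ +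
      1 / π * (240 / T₀ + (1920 + 520 * Real.exp 10 / α ^ 3) / T₀ ^ 2)) :
    Real.sqrt (J * (1 / (2 * α))) ≤
      5 * B / α + Real.exp 12 * m * Real.sqrt Λ / (α * Real.sqrt α) + (7 / Real.sqrt T₀ + 18 / T₀) / Real.sqrt α +
        10 * Real.exp 5 / (α ^ 2 * T₀) := by
  have hT0 : 0 < T₀ := by linarith
  have hsα0 : 0 < Real.sqrt α := Real.sqrt_pos.mpr hα
  have hsα : Real.sqrt α ^ 2 = α := Real.sq_sqrt hα.le
  have hsT0 : 0 < Real.sqrt T₀ := Real.sqrt_pos.mpr hT0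
  have hsT : Real.sqrt T₀ ^ 2 = T₀ := Real.sq_sqrt hT0.le
  have hsΛ : Real.sqrt Λ ^ 2 = Λ := Real.sq_sqrt hΛ
  have hπ3 : 1 / π ≤ 1 / 3 := one_div_le_one_div_of_le (by norm_num) Real.pi_gt_three.le
  have he10 : Real.exp 10 = Real.exp 5 ^ 2 := by rw [← Real.exp_nat_mul]; norm_num
  -- term 1
  have hA : 36 * B ^ 2 / α * (1 / (2 * α)) ≤ (5 * B / α) ^ 2 := by
    have e1 : 36 * B ^ 2 / α * (1 / (2 * α)) = 18 * B ^ 2 / α ^ 2 := by field_simp; ring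
    have e2 : (5 * B / α) ^ 2 = 25 * B ^ 2 / α ^ 2 := by rw [div_pow]; ring
    rw [e1, e2]
    exact div_le_div_of_nonneg_right (by nlinarith [sq_nonneg B]) (by positivity)
  -- term 2 (an equality)
  have hB' : 2 * (Real.exp 12 / α) ^ 2 * m ^ 2 * Λ * (1 / (2 * α)) ≤
      (Real.exp 12 * m * Real.sqrt Λ / (α * Real.sqrt α)) ^ 2 := by
    have e1 : 2 * (Real.exp 12 / α) ^ 2 * m ^ 2 * Λ * (1 / (2 * α)) = Real.exp 12 ^ 2 * m ^ 2 * Λ / α ^ 3 := by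
      field_simp
    have e2 : (Real.exp 12 * m * Real.sqrt Λ / (α * Real.sqrt α)) ^ 2 = Real.exp 12 ^ 2 * m ^ 2 * Λ / α ^ 3 := by
      rw [div_pow, mul_pow, mul_pow, mul_pow, hsΛ, hsα]; ring
    rw [e1, e2]
  -- term 3
  have hC : 1 / π * (240 / T₀ + 1920 / T₀ ^ 2) * (1 / (2 * α)) ≤ ((7 / Real.sqrt T₀ + 18 / T₀) / Real.sqrt α) ^ 2 := by
    have e2 : ((7 / Real.sqrt T₀ + 18 / T₀) / Real.sqrt α) ^ 2 = (7 / Real.sqrt T₀ + 18 / T₀) ^ 2 / α := by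
      rw [div_pow, hsα]
    have hsq : 49 / T₀ + 324 / T₀ ^ 2 ≤ (7 / Real.sqrt T₀ + 18 / T₀) ^ 2 := by
      have h49 : (7 / Real.sqrt T₀) ^ 2 = 49 / T₀ := by rw [div_pow, hsT]; norm_num
      have h324 : (18 / T₀) ^ 2 = 324 / T₀ ^ 2 := by rw [div_pow]; norm_num
      have hcross : 0 ≤ 2 * (7 / Real.sqrt T₀) * (18 / T₀) := by positivity
      nlinarith
    have hstep : 1 / π * (240 / T₀ + 1920 / T₀ ^ 2) * (1 / (2 * α)) ≤ (49 / T₀ + 324 / T₀ ^ 2) / α := by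
      have hpos : 0 ≤ (240 / T₀ + 1920 / T₀ ^ 2) * (1 / (2 * α)) := by positivity
      calc 1 / π * (240 / T₀ + 1920 / T₀ ^ 2) * (1 / (2 * α))
          = 1 / π * ((240 / T₀ + 1920 / T₀ ^ 2) * (1 / (2 * α))) := by ring
        _ ≤ 1 / 3 * ((240 / T₀ + 1920 / T₀ ^ 2) * (1 / (2 * α))) := mul_le_mul_of_nonneg_right hπ3 hpos
        _ = (40 / T₀ + 320 / T₀ ^ 2) / α := by field_simp; ring
        _ ≤ (49 / T₀ + 324 / T₀ ^ 2) / α := by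
            gcongr
            · norm_num
            · norm_num
    rw [e2]
    exact hstep.trans (div_le_div_of_nonneg_right hsq hα.le)
  -- term 4
  have hD : 1 / π * ((520 * Real.exp 10 / α ^ 3) / T₀ ^ 2) * (1 / (2 * α)) ≤ (10 * Real.exp 5 / (α ^ 2 * T₀)) ^ 2 := by
    have e2 : (10 * Real.exp 5 / (α ^ 2 * T₀)) ^ 2 = 100 * Real.exp 10 / (α ^ 4 * T₀ ^ 2) := by
      rw [he10, div_pow, mul_pow, mul_pow]; ring
    have hpos : 0 ≤ ((520 * Real.exp 10 / α ^ 3) / T₀ ^ 2) * (1 / (2 * α)) := by positivity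
    calc 1 / π * ((520 * Real.exp 10 / α ^ 3) / T₀ ^ 2) * (1 / (2 * α))
        = 1 / π * (((520 * Real.exp 10 / α ^ 3) / T₀ ^ 2) * (1 / (2 * α))) := by ring
      _ ≤ 1 / 3 * (((520 * Real.exp 10 / α ^ 3) / T₀ ^ 2) * (1 / (2 * α))) := mul_le_mul_of_nonneg_right hπ3 hpos
      _ = (260 / 3) * Real.exp 10 / (α ^ 4 * T₀ ^ 2) := by field_simp; ring
      _ ≤ 100 * Real.exp 10 / (α ^ 4 * T₀ ^ 2) := by
          gcongr
          norm_num
      _ = (10 * Real.exp 5 / (α ^ 2 * T₀)) ^ 2 := e2.symm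
  -- assemble
  have h0 : 0 < 1 / (2 * α) := by positivity
  have hJ' : J * (1 / (2 * α)) ≤ 36 * B ^ 2 / α * (1 / (2 * α)) + 2 * (Real.exp 12 / α) ^ 2 * m ^ 2 * Λ * (1 / (2 * α)) +
      1 / π * (240 / T₀ + 1920 / T₀ ^ 2) * (1 / (2 * α)) +
        1 / π * ((520 * Real.exp 10 / α ^ 3) / T₀ ^ 2) * (1 / (2 * α)) := by
    have := mul_le_mul_of_nonneg_right hJ h0.le
    refine this.trans (le_of_eq ?_)
    have : (1920 + 520 * Real.exp 10 / α ^ 3) / T₀ ^ 2 = 1920 / T₀ ^ 2 + (520 * Real.exp 10 / α ^ 3) / T₀ ^ 2 := by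
      rw [add_div]
    rw [this]
    ring
  have ht₁ : 0 ≤ 5 * B / α := by positivity
  have ht₂ : 0 ≤ Real.exp 12 * m * Real.sqrt Λ / (α * Real.sqrt α) := by positivity
  have ht₃ : 0 ≤ (7 / Real.sqrt T₀ + 18 / T₀) / Real.sqrt α := by positivity
  have ht₄ : 0 ≤ 10 * Real.exp 5 / (α ^ 2 * T₀) := by positivity
  have hsum : J * (1 / (2 * α)) ≤ (5 * B / α + Real.exp 12 * m * Real.sqrt Λ / (α * Real.sqrt α) +
      (7 / Real.sqrt T₀ + 18 / T₀) / Real.sqrt α + 10 * Real.exp 5 / (α ^ 2 * T₀)) ^ 2 := by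
    refine hJ'.trans (le_trans ?_ (sq_add_four_le ht₁ ht₂ ht₃ ht₄))
    linarith
  calc Real.sqrt (J * (1 / (2 * α))) ≤ Real.sqrt ((5 * B / α + Real.exp 12 * m * Real.sqrt Λ / (α * Real.sqrt α) +
      (7 / Real.sqrt T₀ + 18 / T₀) / Real.sqrt α + 10 * Real.exp 5 / (α ^ 2 * T₀)) ^ 2) := Real.sqrt_le_sqrt hsum
    _ = _ := Real.sqrt_sq (by positivity)

/-- **GS03 (3.8) for the restricted function**: for `x ≥ 3`, `0 < α ≤ 1`, `T₀ ≥ 1`, a block system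
of primes `≤ Q` (`Q ≥ e²`) at level `N = ⌊x⌋`, and `‖𝒢_a(1+α+iy)‖ ≤ B` for `|y| ≤ T₀` (`B ≥ 0`):
`∫_{log 2}^{log x} |A(e^u)| e^{-(1+2α)u} du ≤ 5B/α + e^{12}|𝓙|√(36 log Q + 25)/(α√α) + (7/√T₀ + 18/T₀)/√α + 10e⁵/(α²T₀)`.
[cite: GranvilleSoundararajan2003, (3.8) and Lemma 3.2] -/
theorem inner_integral_restr_le [DecidableEq ι] (h : IsBlockSystem 𝓙 blk ⌊x⌋₊)
    (hg : ∀ m n, g (m * n) = g m * g n) (hg1 : g 1 = 1) (hgb : ∀ n, ‖g n‖ ≤ 1) (hx : 3 ≤ x)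
    {α : ℝ} (hα : 0 < α) (hα1 : α ≤ 1) {T₀ : ℝ} (hT₀ : 1 ≤ T₀) {Q : ℝ} (hQ : Real.exp 2 ≤ Q)
    (hblkQ : ∀ i ∈ 𝓙, ∀ p ∈ blk i, (p : ℝ) ≤ Q) {B : ℝ} (hB0 : 0 ≤ B)
    (hB : ∀ y : ℝ, |y| ≤ T₀ → ‖LSeries (restr 𝓙 blk g ⌊x⌋₊) (1 + α + y * I)‖ ≤ B) :
    ∫ u in Set.Ioc (Real.log 2) (Real.log x),
        ‖psum (mulLog (restr 𝓙 blk g ⌊x⌋₊) ⌊x⌋₊) (Real.exp u)‖ * Real.exp (-((1 + 2 * α) * u)) ≤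
      5 * B / α + Real.exp 12 * 𝓙.card * Real.sqrt (36 * Real.log Q + 25) / (α * Real.sqrt α) +
        (7 / Real.sqrt T₀ + 18 / T₀) / Real.sqrt α + 10 * Real.exp 5 / (α ^ 2 * T₀) := by
  set a := restr 𝓙 blk g ⌊x⌋₊ with ha_def
  have hab : ∀ n, ‖a n‖ ≤ 1 := norm_restr_le_one hgb
  set N : ℕ := ⌊x⌋₊ with hN
  have hx1 : 1 ≤ x := by linarith
  set μ : Measure ℝ := volume.restrict (Set.Ioc (Real.log 2) (Real.log x)) with hμ
  set f : ℝ → ℝ := fun u => ‖psum (mulLog a N) (Real.exp u)‖ * Real.exp (-((1 + α) * u)) with hf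
  set hh : ℝ → ℝ := fun u => Real.exp (-(α * u)) with hhh
  -- the crude bound for the sub-systems and the mean square bound
  set Bc : ℝ := Real.exp 12 / α with hBc
  have hBc' : ∀ i ∈ 𝓙, ∀ y : ℝ, ‖LSeries (restr (𝓙.erase i) blk g N) (1 + α + y * I)‖ ≤ Bc := by
    intro i _ y
    refine (norm_LSeries_restr_le_min (h.mono (Finset.erase_subset i 𝓙)) hg hg1 hgb hx hα hα1 y).trans ?_
    rw [hBc]
    calc Real.exp 12 * min (Real.log x) (1 / α) ≤ Real.exp 12 * (1 / α) := by gcongr; exact min_le_right _ _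
      _ = Real.exp 12 / α := by ring
  set Λ : ℝ := 36 * Real.log Q + 25 with hΛ
  have hQ0 : 0 < Q := lt_of_lt_of_le (Real.exp_pos 2) hQ
  have hlogQ : 0 ≤ Real.log Q := by
    rw [← Real.log_exp 0]; exact Real.log_le_log (Real.exp_pos 0) (le_trans (Real.exp_le_exp.mpr (by norm_num)) hQ)
  have hΛ0 : 0 ≤ Λ := by positivity
  set Jb : ℝ := 36 * B ^ 2 / α + 2 * Bc ^ 2 * (𝓙.card : ℝ) ^ 2 * Λ +
    1 / π * (240 / T₀ + (1920 + 520 * Real.exp 10 / α ^ 3) / T₀ ^ 2) with hJb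
  have hJ := meanSquare_mulLog_restr_le h hg hg1 hgb hα hα1 hT₀ hQ hblkQ hB hBc'
  have hT0 : 0 < T₀ := by linarith
  have hJb0 : 0 ≤ Jb := by positivity
  -- the integrand is `f * h`
  have hfh : ∀ u, ‖psum (mulLog a N) (Real.exp u)‖ * Real.exp (-((1 + 2 * α) * u)) = f u * hh u := by
    intro u
    simp only [hf, hhh]
    rw [mul_assoc, ← Real.exp_add]
    congr 2
    ring
  simp_rw [hfh]
  -- measurability and bounds for Hölder
  have hfmeas : AEStronglyMeasurable f μ := by
    refine (Measurable.aestronglyMeasurable ?_)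
    exact (((MellinPlancherel.measurable_psum _).comp Real.measurable_exp).norm).mul
      (Real.measurable_exp.comp (by fun_prop))
  have hhmeas : AEStronglyMeasurable hh μ := (by fun_prop : Continuous hh).aestronglyMeasurable
  have hlog2 : 0 < Real.log 2 := Real.log_pos (by norm_num)
  have hfbd : ∀ᵐ u ∂μ, ‖f u‖ ≤ x * Real.log x := by
    refine ae_restrict_of_forall_mem measurableSet_Ioc fun u hu => ?_
    have h1 := kernel_le hab N hx1 (by positivity : (0:ℝ) ≤ α / 4) (p := (α / 2, u))
      ⟨⟨by simp only; linarith, by simp only; linarith⟩, hu⟩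
    simp only at h1
    simp only [hf]
    convert h1 using 4
    ring
  have hhbd : ∀ᵐ u ∂μ, ‖hh u‖ ≤ 1 := by
    refine ae_restrict_of_forall_mem measurableSet_Ioc fun u hu => ?_
    simp only [hhh, Real.norm_eq_abs, abs_of_pos (Real.exp_pos _), Real.exp_le_one_iff]
    have : 0 < u := hlog2.trans hu.1
    nlinarith
  have hfmem : MemLp f (ENNReal.ofReal 2) μ := by
    rw [ENNReal.ofReal_ofNat]; exact MemLp.of_bound hfmeas _ hfbd
  have hhmem : MemLp hh (ENNReal.ofReal 2) μ := by
    rw [ENNReal.ofReal_ofNat]; exact MemLp.of_bound hhmeas _ hhbd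
  have hH := integral_mul_le_Lp_mul_Lq_of_nonneg Real.HolderConjugate.two_two
    (Filter.Eventually.of_forall fun u => by positivity)
    (Filter.Eventually.of_forall fun u => (Real.exp_pos _).le) hfmem hhmem
  -- bound the two factors
  have hf2 : ∫ u, f u ^ (2:ℝ) ∂μ ≤ Jb := by
    simp_rw [Real.rpow_two]
    have hint := integrable_meanSquare_integrand hab N hα
    have heq : ∀ u, f u ^ 2 = ‖psum (mulLog a N) (Real.exp u)‖ ^ 2 * Real.exp (-(2 * (1 + α) * u)) := by
      intro u
      simp only [hf]
      rw [mul_pow, ← Real.exp_nat_mul]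
      congr 2
      push_cast
      ring
    simp_rw [heq]
    exact (setIntegral_le_integral hint (Filter.Eventually.of_forall fun u => by positivity)).trans hJ
  have hh2 : ∫ u, hh u ^ (2:ℝ) ∂μ ≤ 1 / (2 * α) := by
    simp_rw [Real.rpow_two]
    have heq : ∀ u, hh u ^ 2 = Real.exp (-(2 * α) * u) := by
      intro u
      simp only [hhh]
      rw [← Real.exp_nat_mul]
      congr 1
      push_cast
      ring
    simp_rw [heq]
    exact setIntegral_exp_neg_le hα
  have hf2_0 : 0 ≤ ∫ u, f u ^ (2:ℝ) ∂μ := integral_nonneg fun u => by positivity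
  have hh2_0 : 0 ≤ ∫ u, hh u ^ (2:ℝ) ∂μ := integral_nonneg fun u => by positivity
  calc ∫ u, f u * hh u ∂μ
      ≤ (∫ u, f u ^ (2:ℝ) ∂μ) ^ (1 / (2:ℝ)) * (∫ u, hh u ^ (2:ℝ) ∂μ) ^ (1 / (2:ℝ)) := hH
    _ ≤ Jb ^ (1 / (2:ℝ)) * (1 / (2 * α)) ^ (1 / (2:ℝ)) := by gcongr
    _ = Real.sqrt (Jb * (1 / (2 * α))) := by
        rw [Real.sqrt_eq_rpow, Real.mul_rpow hJb0 (by positivity)]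
    _ ≤ _ := sqrt_meanSquare_bound_le hα hT₀ hB0 (Nat.cast_nonneg _) hΛ0 (le_of_eq (by simp only [hJb, hBc]))

/-! ### The two extra `α`-integrals -/

/-- `∫_{α₀}^{1} dα/(α√α) ≤ 2/√α₀` (`0 < α₀ ≤ 1`; antiderivative `-2/√α`). [folklore] -/
theorem integral_inv_mul_sqrt_le {α₀ : ℝ} (h0 : 0 < α₀) (h1 : α₀ ≤ 1) :
    ∫ α in α₀..1, 1 / (α * Real.sqrt α) ≤ 2 / Real.sqrt α₀ := by
  have hderiv : ∀ α ∈ Set.uIcc α₀ 1, HasDerivAt (fun α => -2 * (Real.sqrt α)⁻¹) (1 / (α * Real.sqrt α)) α := by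
    intro α hα
    rw [Set.uIcc_of_le h1] at hα
    have hα0 : 0 < α := h0.trans_le hα.1
    have hs0 : 0 < Real.sqrt α := Real.sqrt_pos.mpr hα0
    have hs2 : Real.sqrt α ^ 2 = α := Real.sq_sqrt hα0.le
    have h := ((Real.hasDerivAt_sqrt hα0.ne').inv hs0.ne').const_mul (-2)
    refine h.congr_deriv ?_
    rw [hs2]
    field_simp
  have hint : IntervalIntegrable (fun α : ℝ => 1 / (α * Real.sqrt α)) volume α₀ 1 := by
    refine (continuousOn_const.div ?_ fun α hα => ?_).intervalIntegrable
    · exact continuousOn_id.mul (Real.continuous_sqrt.continuousOn)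
    · rw [Set.uIcc_of_le h1] at hα
      have hα0 : 0 < α := h0.trans_le hα.1
      exact (mul_pos hα0 (Real.sqrt_pos.mpr hα0)).ne'
  rw [intervalIntegral.integral_eq_sub_of_hasDerivAt hderiv hint]
  simp only [Real.sqrt_one, inv_one, mul_one]
  have : 0 ≤ 2 * (Real.sqrt α₀)⁻¹ := by positivity
  rw [div_eq_mul_inv]
  linarith

/-- `∫_{α₀}^{1} dα/√α ≤ 2` (`0 < α₀ ≤ 1`; antiderivative `2√α`). [folklore] -/
theorem integral_inv_sqrt_le {α₀ : ℝ} (h0 : 0 < α₀) (h1 : α₀ ≤ 1) :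
    ∫ α in α₀..1, 1 / Real.sqrt α ≤ 2 := by
  have hderiv : ∀ α ∈ Set.uIcc α₀ 1, HasDerivAt (fun α => 2 * Real.sqrt α) (1 / Real.sqrt α) α := by
    intro α hα
    rw [Set.uIcc_of_le h1] at hα
    have hα0 : 0 < α := h0.trans_le hα.1
    have h := (Real.hasDerivAt_sqrt hα0.ne').const_mul 2
    refine h.congr_deriv ?_
    field_simp
  have hint : IntervalIntegrable (fun α : ℝ => 1 / Real.sqrt α) volume α₀ 1 := by
    refine (continuousOn_const.div Real.continuous_sqrt.continuousOn fun α hα => ?_).intervalIntegrable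
    rw [Set.uIcc_of_le h1] at hα
    exact (Real.sqrt_pos.mpr (h0.trans_le hα.1)).ne'
  rw [intervalIntegral.integral_eq_sub_of_hasDerivAt hderiv hint]
  simp only [Real.sqrt_one, mul_one]
  have : 0 ≤ 2 * Real.sqrt α₀ := by positivity
  linarith

/-- The extra terms `X(α) = F/(α√α) + G/√α` integrate to `≤ 2F/√α₀ + 2G` over `(α₀, 1]`
(`F, G ≥ 0`, `0 < α₀ ≤ 1`), and `X` is integrable there. [folklore] -/
theorem setIntegral_extra_le {α₀ F G : ℝ} (h0 : 0 < α₀) (h1 : α₀ ≤ 1) (hF : 0 ≤ F) (hG : 0 ≤ G) :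
    IntegrableOn (fun α => F / (α * Real.sqrt α) + G / Real.sqrt α) (Set.Ioc α₀ 1) ∧
      ∫ α in Set.Ioc α₀ 1, (F / (α * Real.sqrt α) + G / Real.sqrt α) ≤ 2 * F / Real.sqrt α₀ + 2 * G := by
  have hcont : ContinuousOn (fun α => F / (α * Real.sqrt α) + G / Real.sqrt α) (Set.Icc α₀ 1) := by
    refine ContinuousOn.add (continuousOn_const.div ?_ fun α hα => ?_)
      (continuousOn_const.div Real.continuous_sqrt.continuousOn fun α hα => ?_)
    · exact continuousOn_id.mul Real.continuous_sqrt.continuousOn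
    · have hα0 : 0 < α := h0.trans_le hα.1
      exact (mul_pos hα0 (Real.sqrt_pos.mpr hα0)).ne'
    · exact (Real.sqrt_pos.mpr (h0.trans_le hα.1)).ne'
  have hint : IntegrableOn (fun α => F / (α * Real.sqrt α) + G / Real.sqrt α) (Set.Ioc α₀ 1) :=
    (hcont.integrableOn_Icc).mono_set Set.Ioc_subset_Icc_self
  refine ⟨hint, ?_⟩
  have h1' := integral_inv_mul_sqrt_le h0 h1
  have h2' := integral_inv_sqrt_le h0 h1
  have hi1 : IntervalIntegrable (fun α : ℝ => 1 / (α * Real.sqrt α)) volume α₀ 1 := by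
    refine (continuousOn_const.div ?_ fun α hα => ?_).intervalIntegrable
    · exact continuousOn_id.mul (Real.continuous_sqrt.continuousOn)
    · rw [Set.uIcc_of_le h1] at hα
      have hα0 : 0 < α := h0.trans_le hα.1
      exact (mul_pos hα0 (Real.sqrt_pos.mpr hα0)).ne'
  have hi2 : IntervalIntegrable (fun α : ℝ => 1 / Real.sqrt α) volume α₀ 1 := by
    refine (continuousOn_const.div Real.continuous_sqrt.continuousOn fun α hα => ?_).intervalIntegrable
    rw [Set.uIcc_of_le h1] at hα
    exact (Real.sqrt_pos.mpr (h0.trans_le hα.1)).ne'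
  rw [← intervalIntegral.integral_of_le h1]
  have heq : ∫ α in α₀..1, (F / (α * Real.sqrt α) + G / Real.sqrt α) =
      F * (∫ α in α₀..1, 1 / (α * Real.sqrt α)) + G * (∫ α in α₀..1, 1 / Real.sqrt α) := by
    rw [← intervalIntegral.integral_const_mul, ← intervalIntegral.integral_const_mul,
      ← intervalIntegral.integral_add (hi1.const_mul F) (hi2.const_mul G)]
    refine intervalIntegral.integral_congr fun α _ => ?_
    ring
  rw [heq]
  have hs0 : 0 < Real.sqrt α₀ := Real.sqrt_pos.mpr h0
  calc F * (∫ α in α₀..1, 1 / (α * Real.sqrt α)) + G * (∫ α in α₀..1, 1 / Real.sqrt α)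
      ≤ F * (2 / Real.sqrt α₀) + G * 2 :=
        add_le_add (mul_le_mul_of_nonneg_left h1' hF) (mul_le_mul_of_nonneg_left h2' hG)
    _ = 2 * F / Real.sqrt α₀ + 2 * G := by ring

/-! ### Halász's theorem for the restricted sum -/

set_option maxHeartbeats 1600000 in
-- one long bookkeeping proof (nine term estimates); the default budget is too small
/-- **Halász's theorem for block-restricted sums.**  There is an absolute `K > 0` such that for
every completely multiplicative `g : ℕ → ℂ` with `|g| ≤ 1`, all `x ≥ 3`, `T ≥ 4`, `Q ≥ e²`, every block
system `blk i` (`i ∈ 𝓙 ⊆ ℕ`) of pairwise disjoint sets of primes `≤ min(x, Q)`, with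
`𝒮 = {n : n has a prime factor in every block}` and `M_½ = min_{|t| ≤ T} 𝔻_½(g, n^{it}; x)²`
(`minHalfDistSq`, the blocks' primes weighted `1/2`):

`|∑_{n ≤ x, n ∈ 𝒮} g(n)| ≤ K x ((1 + M_½) e^{-M_½} + 1/T + (|𝓙| + 1) √((log Q + 2)/log x))`.

Proof: Granville–Soundararajan's proof of Halász's theorem (Canad. J. Math. 2003, Thm 1/Cor 1) for
`a = g̃ 1_𝒮`, with the factorisation `𝒢_a = G_∁ ∏(G_i - 1)` and `|e^z - 1| ≤ e^{(K + Re z)/2}`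
(`HalaszRestrictedEuler`), the convolution identity and dyadic tails (`HalaszRestrictedMeanSquare`),
and Lemma 2.1 for `a` (this file). [folklore] -/
theorem norm_restr_sum_le :
    ∃ K : ℝ, 0 < K ∧ ∀ (𝓙 : Finset ℕ) (blk : ℕ → Finset ℕ) (g : ℕ → ℂ),
      (∀ m n, g (m * n) = g m * g n) → g 1 = 1 → (∀ n, ‖g n‖ ≤ 1) →
      ∀ x T Q : ℝ, 3 ≤ x → 4 ≤ T → Real.exp 2 ≤ Q → IsBlockSystem 𝓙 blk ⌊x⌋₊ →
      (∀ i ∈ 𝓙, ∀ p ∈ blk i, (p : ℝ) ≤ Q) →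
        ‖S (restr 𝓙 blk g ⌊x⌋₊) x‖ ≤ K * x *
          ((1 + minHalfDistSq (𝓙.biUnion blk) g x T) * Real.exp (-minHalfDistSq (𝓙.biUnion blk) g x T) +
            1 / T + (𝓙.card + 1) * Real.sqrt ((Real.log Q + 2) / Real.log x)) := by
  classical
  obtain ⟨C₂, hC₂⟩ := exists_sum_abs_psi_sub_mul_kk_le
  set e5 : ℝ := Real.exp 5 with he5
  set e7 : ℝ := Real.exp 7 with he7
  set e12 : ℝ := Real.exp 12 with he12
  set e30 : ℝ := Real.exp 30 with he30
  set K : ℝ := 85 * (e30 + e7) + 340 * e5 + 680 * e5 + 17 * (5 * e12 + 5 * e5) * (e30 + e7) + 306 * e12 +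
    544 * e30 + e30 + |C₂ + 4| * e30 + 2 + e7 + 1 with hK
  have he5pos : 0 < e5 := Real.exp_pos _
  have he7pos : 0 < e7 := Real.exp_pos _
  have he12pos : 0 < e12 := Real.exp_pos _
  have he30pos : 0 < e30 := Real.exp_pos _
  have hKpos : 0 < K := by positivity
  have hK1 : 1 ≤ K := by
    have : 0 ≤ 85 * (e30 + e7) + 340 * e5 + 680 * e5 + 17 * (5 * e12 + 5 * e5) * (e30 + e7) + 306 * e12 +
      544 * e30 + e30 + |C₂ + 4| * e30 + 2 + e7 := by positivity
    linarith
  have hKe7 : e7 ≤ K := by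
    have : 0 ≤ 85 * (e30 + e7) + 340 * e5 + 680 * e5 + 17 * (5 * e12 + 5 * e5) * (e30 + e7) + 306 * e12 +
      544 * e30 + e30 + |C₂ + 4| * e30 + 2 + 1 := by positivity
    linarith
  refine ⟨K, hKpos, ?_⟩
  intro 𝓙 blk g hg hg1 hgb x T Q hx hT hQ hsys hblkQ
  set N : ℕ := ⌊x⌋₊ with hN
  set a := restr 𝓙 blk g N with ha_def
  have hab : ∀ n, ‖a n‖ ≤ 1 := norm_restr_le_one hgb
  set E := 𝓙.biUnion blk with hE
  set M : ℝ := minHalfDistSq E g x T with hM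
  set Φ : ℝ := (1 + M) * Real.exp (-M) with hΦ
  set ℓ : ℝ := Real.log x with hℓ
  set m : ℝ := (𝓙.card : ℝ) with hm
  set ρ : ℝ := Real.sqrt ((Real.log Q + 2) / ℓ) with hρ
  set R : ℝ := Φ + 1 / T + (m + 1) * ρ with hR
  have hx0 : 0 < x := by linarith
  have hx1 : 1 ≤ x := by linarith
  have hℓ1 : 1 < ℓ := by
    rw [hℓ, ← Real.log_exp 1]
    exact Real.log_lt_log (Real.exp_pos 1) (by have := Real.exp_one_lt_d9; linarith)
  have hℓ0 : 0 < ℓ := by linarith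
  have hT0 : 0 < T := by linarith
  have hQ0 : 0 < Q := lt_of_lt_of_le (Real.exp_pos 2) hQ
  have hlogQ2 : 2 ≤ Real.log Q := by
    rw [← Real.log_exp 2]; exact Real.log_le_log (Real.exp_pos 2) hQ
  have hM0 : 0 ≤ M := minHalfDistSq_nonneg hgb E x (by linarith)
  have hMll : M ≤ Real.log ℓ + 30 := minHalfDistSq_le_loglog hgb E hx (by linarith)
  have heM : 0 < Real.exp (-M) := Real.exp_pos _
  have hΦ0 : 0 ≤ Φ := by positivity
  have hm0 : 0 ≤ m := Nat.cast_nonneg _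
  have hρ0 : 0 ≤ ρ := Real.sqrt_nonneg _
  have hll0 : 0 ≤ Real.log ℓ := Real.log_nonneg hℓ1.le
  have hR0 : 0 ≤ R := by positivity
  have hΦR : Φ ≤ R := by
    have : 0 ≤ 1 / T + (m + 1) * ρ := by positivity
    linarith
  have hTR : 1 / T ≤ R := by
    have : 0 ≤ (m + 1) * ρ := by positivity
    linarith
  have hρR : (m + 1) * ρ ≤ R := by
    have : 0 ≤ 1 / T := by positivity
    linarith
  have hA : (1 + Real.log ℓ) / ℓ ≤ e30 * Φ := one_add_loglog_div_le hx hM0 hMll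
  have hA1 : 1 ≤ e30 * Φ * ℓ := by
    have : 1 / ℓ ≤ e30 * Φ := le_trans (by gcongr; linarith) hA
    rwa [div_le_iff₀ hℓ0] at this
  have hS0 : ‖S a x‖ ≤ x := norm_S_le' hab hx0.le
  -- trivial case `ρ > 1`
  by_cases hρ1 : 1 < ρ
  · calc ‖S a x‖ ≤ x := hS0
      _ ≤ K * x * R := by
          have h1 : 1 ≤ (m + 1) * ρ := by nlinarith
          have h2 : x ≤ x * R := by nlinarith [h1.trans hρR]
          nlinarith [h2, hK1, mul_nonneg hx0.le hR0]
  push Not at hρ1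
  -- trivial case `M < 7`
  by_cases hM7 : M < 7
  · have hΦ7 : 8 * Real.exp (-7) ≤ Φ := by
      have := Tao2016.one_add_mul_exp_neg_le hM0 hM7.le
      norm_num at this ⊢
      linarith
    have h77 : e7 * Real.exp (-7) = 1 := by rw [he7, ← Real.exp_add]; simp
    calc ‖S a x‖ ≤ x := hS0
      _ = e7 / 8 * x * (8 * Real.exp (-7)) := by
          rw [show e7 / 8 * x * (8 * Real.exp (-7)) = (e7 * Real.exp (-7)) * x by ring, h77, one_mul]
      _ ≤ e7 / 8 * x * Φ := by gcongr
      _ ≤ K * x * R := by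
          have h1 : e7 / 8 ≤ K := by linarith
          gcongr
  push Not at hM7
  -- the main case `M ≥ 7`, `ρ ≤ 1`
  set Bw : ℝ := e7 * ℓ * Real.exp (-M) with hBw
  have hBw0 : 0 < Bw := by positivity
  have heM7 : Real.exp (-M) ≤ Real.exp (-7) := Real.exp_le_exp.2 (by linarith)
  have h77 : e7 * Real.exp (-7) = 1 := by rw [he7, ← Real.exp_add]; simp
  have hL1 : e7 * Real.exp (-M) ≤ 1 := by
    calc e7 * Real.exp (-M) ≤ e7 * Real.exp (-7) := by gcongr
      _ = 1 := h77
  have hBwℓ : Bw ≤ ℓ := by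
    calc Bw = (e7 * Real.exp (-M)) * ℓ := by rw [hBw]; ring
      _ ≤ 1 * ℓ := by gcongr
      _ = ℓ := one_mul ℓ
  set α₀ : ℝ := 1 / (2 * ℓ) with hα₀
  set α₁ : ℝ := min 1 (1 / Bw) with hα₁
  have hα₀0 : 0 < α₀ := by positivity
  have hα₀1 : α₀ ≤ 1 := by rw [hα₀, div_le_one (by positivity)]; linarith
  have h1 : α₁ ≤ 1 := min_le_left _ _
  have h01 : α₀ ≤ α₁ := by
    refine le_min hα₀1 ?_
    rw [hα₀]; exact one_div_le_one_div_of_le hBw0 (by linarith)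
  have hα₁0 : 0 < α₁ := hα₀0.trans_le h01
  -- Mertens for the `E`-term
  set L : ℝ := Real.log Q + Real.log 4 with hLdef
  have hEsub : E ⊆ Nat.primesLE ⌊Q⌋₊ := by
    intro p hp
    rw [hE, Finset.mem_biUnion] at hp
    obtain ⟨i, hi, hpi⟩ := hp
    rw [Nat.mem_primesLE]
    exact ⟨Nat.le_floor (hblkQ i hi p hpi), hsys.prime_of_mem hi hpi⟩
  have hL : ∑ p ∈ E, Real.log p / p ≤ L := by
    have h1 : ∑ p ∈ E, Real.log p / p ≤ ∑ p ∈ Nat.primesLE ⌊Q⌋₊, Real.log p / p :=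
      Finset.sum_le_sum_of_subset_of_nonneg hEsub fun p hp _ => by
        rw [Nat.mem_primesLE] at hp
        exact div_nonneg (Real.log_nonneg (by exact_mod_cast hp.2.one_lt.le)) (Nat.cast_nonneg p)
    refine h1.trans ((MertensBound.sum_log_div_prime_le ⌊Q⌋₊).trans ?_)
    rw [hLdef]
    gcongr
    · exact Nat.cast_pos.mpr (Nat.floor_pos.mpr (by linarith [Real.add_one_le_exp (2:ℝ)]))
    · exact Nat.floor_le hQ0.le
  have hlog4 : Real.log 4 ≤ 2 := by
    have h2 : Real.log 4 = 2 * Real.log 2 := by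
      rw [show (4:ℝ) = 2 ^ 2 by norm_num, Real.log_pow]; ring
    rw [h2]; linarith [Real.log_two_lt_d9]
  have hL0 : 0 ≤ L := by rw [hLdef]; have := Real.log_nonneg (show (1:ℝ) ≤ 4 by norm_num); linarith
  -- Lemma A2 and the `α`-representation
  have hII := norm_S_restr_mul_log_le_integral hC₂ hsys hg hgb hL hx
  have hB1 := integral_normSExp_le (g := a) hab hx
  set I : ℝ → ℝ := fun α => ∫ u in Set.Ioc (Real.log 2) (Real.log x),
    ‖psum (mulLog a N) (Real.exp u)‖ * Real.exp (-((1 + 2 * α) * u)) with hI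
  have hIint : IntegrableOn I (Set.Ioc α₀ 1) :=
    (integrable_kernel hab N (x := x) (by linarith) hα₀0.le).integral_prod_left
  -- the extra terms
  set F : ℝ := e12 * m * Real.sqrt (36 * Real.log Q + 25) with hF
  set G : ℝ := 7 / Real.sqrt (T / 2) + 18 / (T / 2) with hG
  have hF0 : 0 ≤ F := by positivity
  have hG0 : 0 ≤ G := by positivity
  set X : ℝ → ℝ := fun α => F / (α * Real.sqrt α) + G / Real.sqrt α with hX
  obtain ⟨hXint, hXle⟩ := setIntegral_extra_le (F := F) (G := G) hα₀0 hα₀1 hF0 hG0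
  -- the two per-`α` bounds
  have hT22 : 2 * (T / 2) = T := by ring
  have hT21 : (1 : ℝ) ≤ T / 2 := by linarith
  have hb1 : ∀ α ∈ Set.Icc α₀ α₁, I α - X α ≤ 5 * Bw / α + 20 * e5 * ℓ / T + (20 * e5 / T) / α ^ 2 := by
    intro α hα
    have hα0' : 0 < α := hα₀0.trans_le hα.1
    have hα1' : α ≤ 1 := hα.2.trans h1
    have hB := inner_integral_restr_le hsys hg hg1 hgb hx hα0' hα1' hT21 hQ hblkQ
      (B := Bw + 2 * α / (T / 2) * (e5 * ℓ)) (by positivity) (fun y hy => by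
        have h := norm_LSeries_restr_shift_le hsys hg hg1 hgb hx hα0' (T₀ := T / 2) (by linarith) hy
        rw [hT22] at h
        exact h)
    have hXα : X α = e12 * (𝓙.card : ℝ) * Real.sqrt (36 * Real.log Q + 25) / (α * Real.sqrt α) +
        (7 / Real.sqrt (T / 2) + 18 / (T / 2)) / Real.sqrt α := by simp only [hX, hF, hG, hm, he12]
    have heq : 5 * (Bw + 2 * α / (T / 2) * (e5 * ℓ)) / α + 10 * Real.exp 5 / (α ^ 2 * (T / 2)) =
        5 * Bw / α + 20 * e5 * ℓ / T + (20 * e5 / T) / α ^ 2 := by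
      rw [he5]; field_simp; ring
    simp only [hI]
    linarith [hB, hXα, heq]
  have hb2 : ∀ α ∈ Set.Icc α₁ 1, I α - X α ≤ (5 * e12 + 5 * e5) / α ^ 2 := by
    intro α hα
    have hα0' : 0 < α := hα₁0.trans_le hα.1
    have hα1' : α ≤ 1 := hα.2
    have hB := inner_integral_restr_le hsys hg hg1 hgb hx hα0' hα1' hT21 hQ hblkQ
      (B := e12 / α) (by positivity) (fun y _ => by
        refine (norm_LSeries_restr_le_min hsys hg hg1 hgb hx hα0' hα1' y).trans ?_
        rw [he12]
        calc Real.exp 12 * min (Real.log x) (1 / α) ≤ Real.exp 12 * (1 / α) := by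
              gcongr; exact min_le_right _ _
          _ = Real.exp 12 / α := by ring)
    have hXα : X α = e12 * (𝓙.card : ℝ) * Real.sqrt (36 * Real.log Q + 25) / (α * Real.sqrt α) +
        (7 / Real.sqrt (T / 2) + 18 / (T / 2)) / Real.sqrt α := by simp only [hX, hF, hG, hm, he12]
    have hTinv : 10 * Real.exp 5 / (α ^ 2 * (T / 2)) ≤ 5 * e5 / α ^ 2 := by
      rw [he5, div_le_div_iff₀ (by positivity) (by positivity)]
      have : 0 < Real.exp 5 * α ^ 2 := by positivity
      nlinarith
    have heq : 5 * (e12 / α) / α = 5 * e12 / α ^ 2 := by field_simp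
    simp only [hI]
    have : 5 * e12 / α ^ 2 + 5 * e5 / α ^ 2 = (5 * e12 + 5 * e5) / α ^ 2 := by ring
    linarith [hB, hXα, heq, hTinv]
  have hĨint : IntegrableOn (fun α => I α - X α) (Set.Ioc α₀ 1) := hIint.sub hXint
  have hB3 := setIntegral_le_of_two_regimes hα₀0 h01 h1 hĨint (P := 5 * Bw)
    (c := 20 * e5 * ℓ / T) (E := 20 * e5 / T) (Q := 5 * e12 + 5 * e5) (by positivity) (by positivity)
    (by positivity) hb1 hb2
  have hIsplit : ∫ α in Set.Ioc α₀ 1, I α = (∫ α in Set.Ioc α₀ 1, (I α - X α)) + ∫ α in Set.Ioc α₀ 1, X α := by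
    rw [← integral_add hĨint hXint]
    exact integral_congr_ae (Filter.Eventually.of_forall fun α => by simp only [hX]; ring)
  have hXle' : ∫ α in Set.Ioc α₀ 1, X α ≤ 2 * F * Real.sqrt (2 * ℓ) + 2 * G := by
    refine hXle.trans (le_of_eq ?_)
    rw [hα₀, Real.sqrt_div' 1 (by positivity : (0:ℝ) ≤ 2 * ℓ), Real.sqrt_one]
    field_simp
  -- the common unit `W = R log x`
  set W : ℝ := R * ℓ with hW
  have hW0 : 0 ≤ W := by positivity
  have hΦW : Φ * ℓ ≤ W := mul_le_mul_of_nonneg_right hΦR hℓ0.le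
  have hTW : ℓ / T ≤ W := by
    calc ℓ / T = 1 / T * ℓ := by ring
      _ ≤ R * ℓ := mul_le_mul_of_nonneg_right hTR hℓ0.le
  have h1W : 1 ≤ e30 * W := by
    calc (1:ℝ) ≤ e30 * Φ * ℓ := hA1
      _ = e30 * (Φ * ℓ) := by ring
      _ ≤ e30 * W := mul_le_mul_of_nonneg_left hΦW he30pos.le
  -- t5-style: `log ℓ + 1 ≤ e30 W`
  have ht7 : Real.log ℓ + 1 ≤ e30 * W := by
    have : (1 + Real.log ℓ) ≤ e30 * Φ * ℓ := by
      have := hA; rwa [div_le_iff₀ hℓ0] at this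
    calc Real.log ℓ + 1 = 1 + Real.log ℓ := by ring
      _ ≤ e30 * (Φ * ℓ) := by linarith
      _ ≤ e30 * W := mul_le_mul_of_nonneg_left hΦW he30pos.le
  have ht8 : C₂ + 4 ≤ |C₂ + 4| * e30 * W := by
    have := mul_le_mul_of_nonneg_left h1W (abs_nonneg (C₂ + 4))
    have h2 : C₂ + 4 ≤ |C₂ + 4| := le_abs_self _
    linarith
  -- t9: the Mertens term `2 L ≤ 2 W` (using `ρ ≤ 1`)
  have hρℓW : ρ * ℓ ≤ W := by
    have h1 : ρ ≤ (m + 1) * ρ := by nlinarith only [hm0, hρ0]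
    calc ρ * ℓ ≤ (m + 1) * ρ * ℓ := mul_le_mul_of_nonneg_right h1 hℓ0.le
      _ ≤ R * ℓ := mul_le_mul_of_nonneg_right hρR hℓ0.le
  have ht9 : 2 * L ≤ 2 * W := by
    have hL2 : L ≤ Real.log Q + 2 := by rw [hLdef]; linarith only [hlog4]
    have hρ2 : ρ ^ 2 = (Real.log Q + 2) / ℓ := by
      rw [hρ]; exact Real.sq_sqrt (by positivity)
    have hρℓ : Real.log Q + 2 = ρ ^ 2 * ℓ := by rw [hρ2]; field_simp
    have hρρ : ρ ^ 2 ≤ ρ := by nlinarith only [hρ0, hρ1]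
    have h3 : ρ ^ 2 * ℓ ≤ ρ * ℓ := mul_le_mul_of_nonneg_right hρρ hℓ0.le
    calc 2 * L ≤ 2 * (Real.log Q + 2) := by linarith only [hL2]
      _ = 2 * (ρ ^ 2 * ℓ) := by rw [hρℓ]
      _ ≤ 2 * (ρ * ℓ) := by linarith only [h3]
      _ ≤ 2 * W := by linarith only [hρℓW]
  -- t2: `17 c = 340 e5 ℓ / T ≤ 340 e5 W`
  have ht2 : 17 * (20 * e5 * ℓ / T) ≤ 340 * e5 * W := by
    calc 17 * (20 * e5 * ℓ / T) = 340 * e5 * (ℓ / T) := by ring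
      _ ≤ 340 * e5 * W := mul_le_mul_of_nonneg_left hTW (by positivity)
  -- t3: `17 E/α₀ = 680 e5 ℓ/T ≤ 680 e5 W`
  have ht3 : 17 * ((20 * e5 / T) / α₀) ≤ 680 * e5 * W := by
    have : (20 * e5 / T) / α₀ = 40 * e5 * (ℓ / T) := by rw [hα₀]; field_simp; ring
    rw [this]
    calc 17 * (40 * e5 * (ℓ / T)) = 680 * e5 * (ℓ / T) := by ring
      _ ≤ 680 * e5 * W := mul_le_mul_of_nonneg_left hTW (by positivity)
  -- t4: `17 Q/α₁ ≤ 17 (5e12 + 5e5)(e30 + e7) W`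
  have hBwle : Bw ≤ e7 * W := by
    have hMe : Real.exp (-M) ≤ Φ := by
      have := mul_le_mul_of_nonneg_right (by linarith : (1:ℝ) ≤ 1 + M) heM.le
      rw [hΦ]; linarith
    calc Bw = e7 * (Real.exp (-M) * ℓ) := by rw [hBw]; ring
      _ ≤ e7 * (Φ * ℓ) := by gcongr
      _ ≤ e7 * W := by gcongr
  have ht4 : 17 * ((5 * e12 + 5 * e5) / α₁) ≤ 17 * (5 * e12 + 5 * e5) * (e30 + e7) * W := by
    have hinv : 1 / α₁ ≤ 1 + Bw := one_div_min_le hBw0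
    have h1B : 1 + Bw ≤ (e30 + e7) * W := by linarith
    have hq0 : 0 ≤ 5 * e12 + 5 * e5 := by positivity
    calc 17 * ((5 * e12 + 5 * e5) / α₁) = 17 * (5 * e12 + 5 * e5) * (1 / α₁) := by ring
      _ ≤ 17 * (5 * e12 + 5 * e5) * ((e30 + e7) * W) :=
          mul_le_mul_of_nonneg_left (hinv.trans h1B) (by positivity)
      _ = _ := by ring
  -- t1: `17 · 5Bw log(α₁/α₀) ≤ 85 (e30 + e7) W`
  have ht1 : 17 * (5 * Bw * Real.log (α₁ / α₀)) ≤ 85 * (e30 + e7) * W := by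
    rcases le_or_gt Bw 1 with hB1 | hB1
    · have hα₁1 : α₁ = 1 := min_eq_left (by rw [le_one_div (by norm_num) hBw0]; simpa using hB1)
      have hlog : Real.log (α₁ / α₀) = Real.log 2 + Real.log ℓ := by
        rw [hα₁1, hα₀, one_div_one_div]
        exact Real.log_mul (by norm_num) hℓ0.ne'
      have hl2 : Real.log 2 < 1 := by have := Real.log_two_lt_d9; linarith
      rw [hlog]
      have hlog0 : 0 ≤ Real.log 2 + Real.log ℓ := by
        have := Real.log_pos (show (1:ℝ) < 2 by norm_num); linarith
      calc 17 * (5 * Bw * (Real.log 2 + Real.log ℓ)) ≤ 17 * (5 * 1 * (1 + Real.log ℓ)) := by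
            have h1 : Bw * (Real.log 2 + Real.log ℓ) ≤ 1 * (1 + Real.log ℓ) :=
              mul_le_mul hB1 (by linarith only [hl2]) hlog0 zero_le_one
            linarith only [h1]
        _ ≤ 85 * (e30 * W) := by linarith only [ht7]
        _ ≤ 85 * (e30 + e7) * W := by nlinarith only [he7pos, hW0]
    · have hα₁B : α₁ = 1 / Bw := min_eq_right (by rw [div_le_one hBw0]; exact hB1.le)
      have hlog : Real.log (α₁ / α₀) = Real.log 2 + M - 7 := by
        have hq : α₁ / α₀ = 2 * Real.exp M / e7 := by
          rw [hα₁B, hα₀, hBw, Real.exp_neg]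
          field_simp
        rw [hq, Real.log_div (by positivity) he7pos.ne', Real.log_mul (by norm_num) (Real.exp_pos M).ne',
          Real.log_exp, he7, Real.log_exp]
      have hl2 : Real.log 2 < 1 := by have := Real.log_two_lt_d9; linarith
      have hMΦ : M * Real.exp (-M) ≤ Φ := by
        have : Φ = M * Real.exp (-M) + Real.exp (-M) := by rw [hΦ]; ring
        rw [this]; linarith
      rw [hlog]
      calc 17 * (5 * Bw * (Real.log 2 + M - 7)) ≤ 17 * (5 * Bw * M) := by
            have : Real.log 2 + M - 7 ≤ M := by linarith only [hl2]
            have h2 : 5 * Bw * (Real.log 2 + M - 7) ≤ 5 * Bw * M := mul_le_mul_of_nonneg_left this (by positivity)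
            linarith only [h2]
        _ = 85 * e7 * ℓ * (M * Real.exp (-M)) := by rw [hBw]; ring
        _ ≤ 85 * e7 * ℓ * Φ := mul_le_mul_of_nonneg_left hMΦ (by positivity)
        _ = 85 * e7 * (Φ * ℓ) := by ring
        _ ≤ 85 * e7 * W := mul_le_mul_of_nonneg_left hΦW (by positivity)
        _ ≤ 85 * (e30 + e7) * W := by nlinarith only [he30pos, hW0]
  -- t5: `17 · 2F √(2ℓ) ≤ 306 e12 W`
  have ht5 : 17 * (2 * F * Real.sqrt (2 * ℓ)) ≤ 306 * e12 * W := by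
    have hs2 : Real.sqrt 2 ≤ 3 / 2 := by
      rw [Real.sqrt_le_left (by norm_num)]; norm_num
    have hΛ : Real.sqrt (36 * Real.log Q + 25) ≤ 6 * Real.sqrt (Real.log Q + 2) := by
      rw [show (6:ℝ) = Real.sqrt 36 by rw [show (36:ℝ) = 6^2 by norm_num, Real.sqrt_sq (by norm_num)],
        ← Real.sqrt_mul (by norm_num)]
      exact Real.sqrt_le_sqrt (by linarith)
    have hsplit : Real.sqrt (2 * ℓ) = Real.sqrt 2 * Real.sqrt ℓ := Real.sqrt_mul (by norm_num) ℓ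
    have hsl0 : 0 < Real.sqrt ℓ := Real.sqrt_pos.mpr hℓ0
    have hρℓ : Real.sqrt (Real.log Q + 2) * Real.sqrt ℓ = ρ * ℓ := by
      rw [hρ, Real.sqrt_div' _ hℓ0.le, div_mul_eq_mul_div, eq_div_iff hsl0.ne']
      calc Real.sqrt (Real.log Q + 2) * Real.sqrt ℓ * Real.sqrt ℓ
          = Real.sqrt (Real.log Q + 2) * (Real.sqrt ℓ * Real.sqrt ℓ) := by ring
        _ = Real.sqrt (Real.log Q + 2) * ℓ := by rw [Real.mul_self_sqrt hℓ0.le]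
    have hmρW : m * (ρ * ℓ) ≤ W := by
      have h1 : m * ρ ≤ (m + 1) * ρ := by nlinarith only [hm0, hρ0]
      calc m * (ρ * ℓ) = m * ρ * ℓ := by ring
        _ ≤ (m + 1) * ρ * ℓ := mul_le_mul_of_nonneg_right h1 hℓ0.le
        _ ≤ R * ℓ := mul_le_mul_of_nonneg_right hρR hℓ0.le
    calc 17 * (2 * F * Real.sqrt (2 * ℓ))
        = 34 * e12 * m * (Real.sqrt (36 * Real.log Q + 25) * (Real.sqrt 2 * Real.sqrt ℓ)) := by
          rw [hF, hsplit]; ring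
      _ ≤ 34 * e12 * m * ((6 * Real.sqrt (Real.log Q + 2)) * ((3 / 2) * Real.sqrt ℓ)) := by
          have hs2' : Real.sqrt 2 * Real.sqrt ℓ ≤ 3 / 2 * Real.sqrt ℓ :=
            mul_le_mul_of_nonneg_right hs2 (Real.sqrt_nonneg ℓ)
          have hprod := mul_le_mul hΛ hs2' (by positivity) (by positivity)
          exact mul_le_mul_of_nonneg_left hprod (by positivity)
      _ = 306 * e12 * (m * (Real.sqrt (Real.log Q + 2) * Real.sqrt ℓ)) := by ring
      _ = 306 * e12 * (m * (ρ * ℓ)) := by rw [hρℓ]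
      _ ≤ 306 * e12 * W := by gcongr
  -- t6: `17 · 2G ≤ 544 e30 W`
  have ht6 : 17 * (2 * G) ≤ 544 * e30 * W := by
    have hG16 : G ≤ 16 := by
      rw [hG]
      have h1 : 7 / Real.sqrt (T / 2) ≤ 7 := div_le_self (by norm_num) (Real.one_le_sqrt.mpr hT21)
      have h2 : 18 / (T / 2) ≤ 9 := by
        rw [div_le_iff₀ (by linarith only [hT])]; linarith only [hT]
      linarith only [h1, h2]
    calc 17 * (2 * G) ≤ 17 * (2 * 16) := by linarith only [hG16]
      _ = 544 * 1 := by norm_num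
      _ ≤ 544 * (e30 * W) := by linarith only [h1W]
      _ = 544 * e30 * W := by ring
  -- assemble
  have hmain : ‖S a x‖ * ℓ ≤ K * W * x := by
    have hsum : 17 * (∫ α in Set.Ioc α₀ 1, I α) + (Real.log ℓ + 1) + (C₂ + 4 + 2 * L) ≤ K * W := by
      rw [hIsplit]
      have hbd : 17 * ((∫ α in Set.Ioc α₀ 1, (I α - X α)) + ∫ α in Set.Ioc α₀ 1, X α) ≤
          17 * (5 * Bw * Real.log (α₁ / α₀) + 20 * e5 * ℓ / T + (20 * e5 / T) / α₀ + (5 * e12 + 5 * e5) / α₁) +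
            17 * (2 * F * Real.sqrt (2 * ℓ) + 2 * G) := by
        have := add_le_add hB3 hXle'
        linarith
      have hK' : 85 * (e30 + e7) * W + 340 * e5 * W + 680 * e5 * W + 17 * (5 * e12 + 5 * e5) * (e30 + e7) * W +
          306 * e12 * W + 544 * e30 * W + e30 * W + |C₂ + 4| * e30 * W + 2 * W ≤ K * W := by
        have hsumK : 85 * (e30 + e7) + 340 * e5 + 680 * e5 + 17 * (5 * e12 + 5 * e5) * (e30 + e7) +
            306 * e12 + 544 * e30 + e30 + |C₂ + 4| * e30 + 2 ≤ K := by
          rw [hK]; linarith only [he7pos]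
        have := mul_le_mul_of_nonneg_right hsumK hW0
        linarith only [this]
      linarith only [hbd, ht1, ht2, ht3, ht4, ht5, ht6, ht7, ht8, ht9, hK']
    have hint0 : 0 ≤ ∫ u in Real.log 2..Real.log x, normSExp a u :=
      intervalIntegral.integral_nonneg (Real.log_le_log (by norm_num) (by linarith))
        fun u _ => normSExp_nonneg a u
    have hB1' : (∫ u in Real.log 2..Real.log x, normSExp a u) ≤
        17 * (∫ α in Set.Ioc α₀ 1, I α) + (Real.log ℓ + 1) := hB1
    calc ‖S a x‖ * ℓ ≤ x * (∫ u in Real.log 2..Real.log x, normSExp a u) + (C₂ + 4 + 2 * L) * x := hII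
      _ ≤ x * (17 * (∫ α in Set.Ioc α₀ 1, I α) + (Real.log ℓ + 1)) + (C₂ + 4 + 2 * L) * x :=
          add_le_add (mul_le_mul_of_nonneg_left hB1' hx0.le) le_rfl
      _ = x * (17 * (∫ α in Set.Ioc α₀ 1, I α) + (Real.log ℓ + 1) + (C₂ + 4 + 2 * L)) := by ring
      _ ≤ x * (K * W) := mul_le_mul_of_nonneg_left hsum hx0.le
      _ = K * W * x := by ring
  -- divide by `log x`
  have hfinal : ‖S a x‖ ≤ K * x * R := by
    have h := hmain
    rw [hW] at h
    have : K * (R * ℓ) * x = (K * x * R) * ℓ := by ring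
    rw [this] at h
    exact le_of_mul_le_mul_right h hℓ0
  exact hfinal

end Restricted

end Halasz

end Literature.NumberTheory.LFunctions
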